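import Summits.HubbardSuperconductivity.HubbardLadder.R91RaCollect

/-!
# R91 route (R-a), part 2: `PosRowCollected` (the positivity / translation Gram window in collected form)

HONEST FRAMING: ladder R1–R4 with certified numbers; no claim on H/H₀.  Companion of `R91RaCollect.lean` (part 1:
definitions `dot` / `lag` / `rpCollect` / `posCollect` / `tab`, the SPEC statements, the transverse fibre lemma
`sum_lag_mul` and `rpRowCollected`); split by the 400-line cap only.  Pen: r2-eng-2 g3 (lead g24 GO, HOME/INBOX l.3390).
-/

namespace Summit.HubbardSuperconductivity.HubbardLadder.R91Ra

open Finset Literature.MathematicalPhysics.QuantumLattice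

/-! ### `PosRowCollected` -/

/-- `dot` is symmetric. -/
theorem dot_comm (u v : List ℤ) : dot u v = dot v u := by
  induction u generalizing v with
  | nil => rw [dot_nil_left, dot_nil_right]
  | cons x xs ih =>
    cases v with
    | nil => rw [dot_nil_left, dot_nil_right]
    | cons y ys => rw [dot_cons_cons, dot_cons_cons, ih ys, mul_comm]

/-- `lag` is symmetric in the two rows. -/
theorem lag_comm (u v : List ℤ) (b : ℕ) : lag u v b = lag v u b := by
  unfold lag
  split_ifs
  · exact dot_comm u v
  · exact add_comm _ _

/-- fibre of the row offset for the POS window: `Σ_{i,i' < s, |i-i'| = da} lag (V i) (V i') db = posCollect V da db`. -/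
theorem posCollect_eq_fiber (V : List (List ℤ)) (s : ℕ) (hV : V.length = s) (da db : ℕ) :
    (∑ p ∈ (range s ×ˢ range s).filter (fun p : ℕ × ℕ => Int.natAbs ((p.1 : ℤ) - p.2) = da),
      lag (V.getD p.1 []) (V.getD p.2 []) db) = posCollect V da db := by
  rw [Finset.sum_filter, Finset.sum_product]
  unfold posCollect
  rw [hV]
  by_cases hda : da = 0
  · subst hda
    have hcond : ∀ i i' : ℕ, (Int.natAbs ((i : ℤ) - i') = 0) ↔ i = i' := by
      intro i i'; rw [natAbs_sub_natCast_eq_iff]; omega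
    simp_rw [hcond, Finset.sum_ite_eq, Finset.mem_range]
    rw [if_pos trivial, list_sum_map_range]
    refine Finset.sum_congr rfl fun i hi => ?_
    rw [Finset.mem_range] at hi
    rw [if_pos hi]
  · rw [if_neg hda, list_sum_map_range]
    have hsplit : ∀ i i' : ℕ, (if Int.natAbs ((i : ℤ) - i') = da then lag (V.getD i []) (V.getD i' []) db else 0) =
        (if i' = i + da then lag (V.getD i []) (V.getD i' []) db else 0) +
        (if i = i' + da then lag (V.getD i []) (V.getD i' []) db else 0) := by
      intro i i'
      have key := natAbs_sub_natCast_eq_iff i i' da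
      by_cases h1 : i' = i + da
      · have hc : Int.natAbs ((i : ℤ) - i') = da := key.mpr (Or.inr h1)
        have h2 : ¬ i = i' + da := by omega
        rw [if_pos hc, if_pos h1, if_neg h2, add_zero]
      · by_cases h2 : i = i' + da
        · have hc : Int.natAbs ((i : ℤ) - i') = da := key.mpr (Or.inl h2)
          rw [if_pos hc, if_neg h1, if_pos h2, zero_add]
        · have hc : ¬ Int.natAbs ((i : ℤ) - i') = da := fun h => by
            rcases key.mp h with h | h <;> omega
          rw [if_neg hc, if_neg h1, if_neg h2, add_zero]
    simp_rw [hsplit, Finset.sum_add_distrib]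
    -- orientation 1: Σ_i Σ_i' [i' = i+da] lag(V_i, V_i') = Σ_{i<s-da} lag (V_i) (V_{i+da})
    have h1 : (∑ i ∈ range s, ∑ i' ∈ range s, if i' = i + da then lag (V.getD i []) (V.getD i' []) db else 0) =
        ∑ i ∈ range (s - da), lag (V.getD i []) (V.getD (i + da) []) db := by
      have step : ∀ i ∈ range s, (∑ i' ∈ range s, if i' = i + da then lag (V.getD i []) (V.getD i' []) db else 0) =
          if i + da < s then lag (V.getD i []) (V.getD (i + da) []) db else 0 := by
        intro i _
        rw [Finset.sum_ite_eq' (range s) (i + da) (fun i' => lag (V.getD i []) (V.getD i' []) db)]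
        by_cases h : i + da < s
        · rw [if_pos (Finset.mem_range.mpr h), if_pos h]
        · rw [if_neg (fun hh => h (Finset.mem_range.mp hh)), if_neg h]
      rw [Finset.sum_congr rfl step, ← Finset.sum_filter]
      refine Finset.sum_congr ?_ fun _ _ => rfl
      ext i
      simp only [Finset.mem_filter, Finset.mem_range]
      omega
    -- orientation 2: Σ_i Σ_i' [i = i'+da] lag(V_i, V_i') = Σ_{i'<s-da} lag (V_{i'+da}) (V_i') = Σ lag (V_i') (V_{i'+da}) by symmetry
    have h2 : (∑ i ∈ range s, ∑ i' ∈ range s, if i = i' + da then lag (V.getD i []) (V.getD i' []) db else 0) =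
        ∑ i' ∈ range (s - da), lag (V.getD i' []) (V.getD (i' + da) []) db := by
      rw [Finset.sum_comm]
      have step : ∀ i' ∈ range s, (∑ i ∈ range s, if i = i' + da then lag (V.getD i []) (V.getD i' []) db else 0) =
          if i' + da < s then lag (V.getD i' []) (V.getD (i' + da) []) db else 0 := by
        intro i' _
        rw [Finset.sum_ite_eq' (range s) (i' + da) (fun i => lag (V.getD i []) (V.getD i' []) db)]
        by_cases h : i' + da < s
        · rw [if_pos (Finset.mem_range.mpr h), if_pos h, lag_comm]
        · rw [if_neg (fun hh => h (Finset.mem_range.mp hh)), if_neg h]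
      rw [Finset.sum_congr rfl step, ← Finset.sum_filter]
      refine Finset.sum_congr ?_ fun _ _ => rfl
      ext i
      simp only [Finset.mem_filter, Finset.mem_range]
      omega
    rw [h1, h2, ← Finset.sum_add_distrib]
    refine Finset.sum_congr rfl fun i _ => ?_
    ring

/-- the row regrouping with a weight (POS): `Σ_{da<s} posCollect V da db · h da = Σ_{i,i'<s} lag (V i) (V i') db · h |i-i'|`. -/
theorem sum_posCollect_mul (V : List (List ℤ)) (s : ℕ) (hV : V.length = s) (db : ℕ) (h : ℕ → ℝ) :
    ∑ da ∈ range s, (posCollect V da db : ℝ) * h da =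
      ∑ i ∈ range s, ∑ i' ∈ range s, (lag (V.getD i []) (V.getD i' []) db : ℝ) * h (Int.natAbs ((i : ℤ) - i')) := by
  rw [← Finset.sum_product' (range s) (range s)
    (fun i i' => (lag (V.getD i []) (V.getD i' []) db : ℝ) * h (Int.natAbs ((i : ℤ) - i')))]
  rw [← Finset.sum_fiberwise_of_maps_to (s := range s ×ˢ range s) (t := range s)
    (g := fun p : ℕ × ℕ => Int.natAbs ((p.1 : ℤ) - p.2)) (fun p hp => by
      rw [Finset.mem_product, Finset.mem_range, Finset.mem_range] at hp
      rw [Finset.mem_range]; omega)]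
  refine Finset.sum_congr rfl fun da _ => ?_
  rw [← posCollect_eq_fiber V s hV da db]
  push_cast
  rw [Finset.sum_mul]
  refine Finset.sum_congr rfl fun p hp => ?_
  rw [Finset.mem_filter] at hp
  rw [hp.2]

/-- **The positivity (translation) Gram window inequality in collected form** (r2 g34's SPEC `PosRowCollected`):
for an integer `s × s` table `V`, `0 ≤ Σ_{da<s} Σ_{db<s} posCollect V da db · c_L(da,db)` on every torus.
[cite: KLS1988JSP, p. 1021] -/
theorem posRowCollected : PosRowCollected := by
  intro L _ n s V hV hrow
  have hlen : ∀ i, i < s → (V.getD i []).length = s := fun i hi =>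
    hrow _ (getD_row_mem V i (by omega))
  have h := heis_transGramWindow_range L n s s (tab V)
  have hR : (∑ i ∈ range s, ∑ t ∈ range s, ∑ i' ∈ range s, ∑ t' ∈ range s,
      tab V i t * tab V i' t' * heisRedCorr2 L n (Int.natAbs ((i : ℤ) - i')) (Int.natAbs ((t : ℤ) - t'))) =
      ∑ i ∈ range s, ∑ i' ∈ range s, ∑ db ∈ range s,
        (lag (V.getD i []) (V.getD i' []) db : ℝ) * heisRedCorr2 L n (Int.natAbs ((i : ℤ) - i')) db := by
    refine Finset.sum_congr rfl fun i hi => ?_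
    rw [Finset.sum_comm]
    refine Finset.sum_congr rfl fun i' hi' => ?_
    rw [Finset.mem_range] at hi hi'
    exact (sum_lag_mul (V.getD i []) (V.getD i' []) s (hlen i hi) (hlen i' hi')
      (fun db => heisRedCorr2 L n (Int.natAbs ((i : ℤ) - i')) db)).symm
  rw [hR] at h
  have hL : (∑ da ∈ range s, ∑ db ∈ range s, (posCollect V da db : ℝ) * heisRedCorr2 L n da db) =
      ∑ i ∈ range s, ∑ i' ∈ range s, ∑ db ∈ range s,
        (lag (V.getD i []) (V.getD i' []) db : ℝ) * heisRedCorr2 L n (Int.natAbs ((i : ℤ) - i')) db := by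
    rw [Finset.sum_comm]
    rw [Finset.sum_congr rfl fun db _ => sum_posCollect_mul V s hV db (fun da => heisRedCorr2 L n da db)]
    rw [Finset.sum_comm]
    refine Finset.sum_congr rfl fun i _ => ?_
    rw [Finset.sum_comm]
  rw [hL]
  exact h

/-! ### Ready-to-instantiate corollary (POS) -/

/-- POS window row in collected form for a concrete table (corollary of `posRowCollected`). -/
theorem pos_row_collected (L : ℕ) [NeZero L] (n s : ℕ) (V : List (List ℤ))
    (hV : V.length = s) (hrow : ∀ r ∈ V, r.length = s) :
    0 ≤ ∑ da ∈ range s, ∑ db ∈ range s, (posCollect V da db : ℝ) * heisRedCorr2 L n da db :=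
  posRowCollected L n s V hV hrow

/-! ### Aggregation (POS) -/

/-- `Σ_r Y_r · posCollect V_r da db` over a list of weighted tables. -/
def posCombine : List (ℕ × List (List ℤ)) → ℕ → ℕ → ℤ
  | [], _, _ => 0
  | (y, V) :: rs, da, db => (y : ℤ) * posCollect V da db + posCombine rs da db

/-- **Combined POS row** (same, for the translation windows `s × s`). -/
theorem pos_rows_combined (L : ℕ) [NeZero L] (n s : ℕ)
    (rows : List (ℕ × List (List ℤ)))
    (hshape : ∀ r ∈ rows, r.2.length = s ∧ ∀ row ∈ r.2, row.length = s) :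
    0 ≤ ∑ da ∈ range s, ∑ db ∈ range s, (posCombine rows da db : ℝ) * heisRedCorr2 L n da db := by
  induction rows with
  | nil => simp [posCombine]
  | cons r rs ih =>
    obtain ⟨y, V⟩ := r
    have hV := hshape (y, V) (by simp)
    have hrs : ∀ r ∈ rs, r.2.length = s ∧ ∀ row ∈ r.2, row.length = s :=
      fun r hr => hshape r (List.mem_cons_of_mem _ hr)
    have h1 := posRowCollected L n s V hV.1 hV.2
    have h2 := ih hrs
    have hsplit : (∑ da ∈ range s, ∑ db ∈ range s, (posCombine ((y, V) :: rs) da db : ℝ) * heisRedCorr2 L n da db) =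
        (y : ℝ) * (∑ da ∈ range s, ∑ db ∈ range s, (posCollect V da db : ℝ) * heisRedCorr2 L n da db) +
        ∑ da ∈ range s, ∑ db ∈ range s, (posCombine rs da db : ℝ) * heisRedCorr2 L n da db := by
      rw [Finset.mul_sum, ← Finset.sum_add_distrib]
      refine Finset.sum_congr rfl fun da _ => ?_
      rw [Finset.mul_sum, ← Finset.sum_add_distrib]
      refine Finset.sum_congr rfl fun db _ => ?_
      simp only [posCombine]
      push_cast
      ring
    rw [hsplit]
    have hy : (0 : ℝ) ≤ (y : ℝ) := Nat.cast_nonneg y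
    nlinarith

/-- **Combined POS row read off a literal table** (same entry point for the translation windows). -/
theorem pos_rows_combined_table (L : ℕ) [NeZero L] (n s : ℕ)
    (rows : List (ℕ × List (List ℤ)))
    (hshape : ∀ r ∈ rows, r.2.length = s ∧ ∀ row ∈ r.2, row.length = s) (T : List (List ℤ))
    (hT : ((List.range s).map fun da => (List.range s).map fun db => posCombine rows da db) = T) :
    0 ≤ ∑ da ∈ range s, ∑ db ∈ range s, (((T.getD da []).getD db 0 : ℤ) : ℝ) * heisRedCorr2 L n da db := by
  rw [← sum_range_range_eq_table (posCombine rows) (fun da db => heisRedCorr2 L n da db) s s T hT]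
  exact pos_rows_combined L n s rows hshape

/-! ### Sanity (POS): kernel `decide` on the 2×2 toy table -/

/-- same table, POS collection: `posCollect V 0 b = lag(V₀,V₀,b) + lag(V₁,V₁,b)`, `posCollect V 1 b = 2·lag(V₀,V₁,b)`. -/
example : (posCollect [[1, 2], [3, 4]] 0 0, posCollect [[1, 2], [3, 4]] 0 1,
    posCollect [[1, 2], [3, 4]] 1 0, posCollect [[1, 2], [3, 4]] 1 1) = (30, 28, 22, 20) := by decide

end Summit.HubbardSuperconductivity.HubbardLadder.R91Ra
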